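import Literature.AlgebraicGeometry.HodgeTheory.HyperplaneDivisorTopologicalClass
import Literature.AlgebraicGeometry.HodgeTheory.ChernCharacterTautologicalPullback
import Literature.AlgebraicGeometry.HodgeTheory.AmpleDivisorChernClassNeZero
import HarnessLib

/-!
# The top ↔ Chern–Weil LINE bridge: the topological Euler class of `𝒪(-1)` along `ψ : Y ⟶ ℙᴷ` is a non-zero multiple of the Chern–Weil class

Family `hodge`, layer `Literature/AlgebraicGeometry/HodgeTheory`, namespace `Literature.AlgebraicGeometry.HodgeTheory`.  THEOREMS ONLY
(no definition, no named fact, no instance).  The tree carries TWO first Chern classes of line bundles on the real carrier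
`H²(–(ℂ); ℂ)`: the TOPOLOGICAL Euler class of a continuous line cocycle (★ `LineEulerClass`, `eulerClass … ℂ 1`, Milnor–Stasheff §14:
`c₁ = e` for line bundles; here of the cocycles `UnitCocycle.complexCore` of algebraic line bundles, ★ `LineBundleTopologicalChernClass`),
and the CHERN–WEIL class `HodgeModel.chernCharacter A V 1` of a holomorphic cocycle on a Hodge model (Kobayashi II Thm. 2.16; normalised by
the model's de Rham comparison, i.e. only up to one non-zero scalar per model).  No general comparison theorem between them is in the tree.
This file proves the comparison where it is CHEAP — on LINE BUNDLES PULLED BACK FROM PROJECTIVE SPACE, on which both classes live on the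
one-dimensional `H²(ℙᴷ(ℂ); ℂ)` (Hatcher Thm. 3.19) and are both non-zero:

* `exists_smul_eq_of_ne_zero_complexBetti_projectiveSpace_two` — `H²(ℙᴷ(ℂ); ℂ)` is a line (`K ≥ 1`): any class is a multiple of any
  non-zero class (★ `finrank_complexBetti_projectiveSpace_two_mul_eq_one`);
* `chernCharacter_tautologicalBundle_projectiveSpace_ne_zero` — the Chern–Weil class `c_B := ch₁ᴮ(𝒪(-1))` of the tautological cocycle
  (★ `AnalytificationKaehler.tautologicalBundle (𝟙 ℙᴷ)`) is non-zero (`ch(D_𝟙) = -c_B`, ★ `chernCharacter_cartierDivisorCocycle_divisor_eq_neg`;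
  `ch(D_𝟙) ≠ 0` for the ample hyperplane divisor, ★ `chernCharacter_cartierDivisorCocycle_ne_zero_of_isAmple`, Voisin I Thm. 7.10 / 11.33);
* **`exists_ne_zero_coreEulerClass_eq_smul_chernCharacter_projectiveSpace`** — `e_ℂ(𝒪_{ℙᴷ}(-D_𝟙)^top) = μ • c_B` for ONE `μ ≠ 0`
  (★ `coreEulerClass_neg_divisor_projectiveSpace_ne_zero`: the topological class is `projPoint`-transported `e(γ¹) ≠ 0`, Milnor–Stasheff 14.4);
* **`exists_ne_zero_coreEulerClass_eq_smul_chernCharacter_pullback`** — for every morphism `ψ : Y ⟶ ℙᴷ` from a smooth projective `Y` of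
  dimension `n ≤ K` with Hodge model `A`: `e_ℂ(𝒪_Y(-D_ψ)^top) = ν • ch₁ᴬ((ψ^an)⁻¹ 𝒪(-1))`, `ν ≠ 0` — naturality of the topological class
  (★ `coreEulerClass_neg_divisor_eq_map`, Husemoller (C₁)) against Kobayashi's naturality axiom up to the models' scalar
  (★ `HodgeModel.exists_chernCharacter_tautologicalBundle_pullback_eq_smul_map`).

So on every fibre of a polarised family the LINE `ℂ · e_ℂ(𝒪(-D_ψ)^top) = ℂ · ch₁ᴬ(𝒪(-1)|_Y)` is the same in both currencies; the cell
`hodgecm-mathlib` (U)-lane consumes this ((N3-core) assembler: the topological class is the restriction of a GLOBAL class of the total space —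
flat by ★ `FlatFrameCoefficientsOfGlobalClass` —, the Chern–Weil class is computed on the torus (T3)).  Leaf (T2½) file (D).  HC_CM is proved
only modulo the 7 printed citations until rung 0 closes, and this file discharges none of them.

## References
* [MilnorStasheff1974] J. Milnor, J. Stasheff, *Characteristic Classes* (1974), §14 p. 158 and Thm. 14.4.
* [Kobayashi1987] S. Kobayashi, *Differential Geometry of Complex Vector Bundles* (1987), Ch. II §1 Axiom 2, §2 Thm. 2.16.
* [VoisinHodgeI2002] C. Voisin, *Hodge Theory and Complex Algebraic Geometry I* (2002), §7.1 Thm. 7.10, §11.1.2 Thm. 11.33, Thm. 7.14.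
* [HatcherAT2002] A. Hatcher, *Algebraic Topology* (2002), Thm. 3.19.
* [HusemollerFibreBundles1994] D. Husemoller, *Fibre Bundles*, 3rd ed. (1994), Ch. 17 Prop. 3.3.
-/

set_option autoImplicit false

noncomputable section

open CategoryTheory AlgebraicGeometry TopologicalSpace Opposite
open scoped Manifold ContDiff
open Literature.AlgebraicGeometry.Motives Literature.AlgebraicGeometry.Motives.AlgPoints
  Literature.AlgebraicGeometry.Motives.AnalytificationKaehler Literature.AlgebraicGeometry.Modules
  Literature.AlgebraicTopology.CharacteristicClasses Literature.AlgebraicTopology.SingularHomology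
  Literature.NumberTheory.Transcendental Literature.Geometry.Kaehler

namespace Literature.AlgebraicGeometry.HodgeTheory

/-! ### §1 `H²(ℙᴷ(ℂ); ℂ)` is a line -/

section Line

variable {K : ℕ}

/-- **`H²(ℙᴷ(ℂ); ℂ)` is a line** (`K ≥ 1`): every class is a multiple of any non-zero class, and the multiplier is non-zero when the class is
(Hatcher Thm. 3.19: `dim H²(ℂPᴷ) = 1`). [cite: HatcherAT2002, Thm. 3.19] -/
theorem exists_smul_eq_of_ne_zero_complexBetti_projectiveSpace_two (hK : 1 ≤ K) {x : complexBetti (projectiveSpace K ℂ) 2} (hx : x ≠ 0)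
    (y : complexBetti (projectiveSpace K ℂ) 2) : ∃ μ : ℂ, y = μ • x ∧ (y ≠ 0 → μ ≠ 0) := by
  have h1 : Module.finrank ℂ (complexBetti (projectiveSpace K ℂ) 2) = 1 :=
    finrank_complexBetti_projectiveSpace_two_mul_eq_one K (p := 1) hK
  obtain ⟨μ, hμ⟩ := (finrank_eq_one_iff_of_nonzero' x hx).1 h1 y
  refine ⟨μ, hμ.symm, fun hy hμ0 ↦ hy ?_⟩
  rw [← hμ, hμ0, zero_smul]

end Line

/-! ### §2 On `ℙᴷ`: the Chern–Weil class of `𝒪(-1)` is non-zero, and the topological class is a non-zero multiple of it -/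

section ProjectiveSpace

variable {K : ℕ} (B : HodgeModel K (projectiveSpace K ℂ))

/-- **`ch₁ᴮ(𝒪_{ℙᴷ}(-1)) ≠ 0`** (`K ≥ 1`): `ch₁ᴮ(𝒪(D_𝟙)) = -ch₁ᴮ(𝒪(-1))` for the hyperplane divisor `D_𝟙` of `ℙᴷ`
(★ `chernCharacter_cartierDivisorCocycle_divisor_eq_neg`) and the class of the AMPLE divisor `D_𝟙` is non-zero
(★ `chernCharacter_cartierDivisorCocycle_ne_zero_of_isAmple`; Voisin I Thm. 7.10 / 11.33). [cite: VoisinHodgeI2002, §7.1 Thm. 7.10 and Thm. 11.33] -/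
theorem chernCharacter_tautologicalBundle_projectiveSpace_ne_zero (j : Fin (K + 1))
    (hj : genericPoint (projectiveSpace K ℂ).left ∈ (GeneratingSections.affineChartData (𝟙 (projectiveSpace K ℂ))).U j) (hK : 1 ≤ K) :
    B.chernCharacter (tautologicalBundle (𝟙 (projectiveSpace K ℂ)) B.isAnalytification) 1 ≠ 0 := by
  intro h0
  haveI hid : IsClosedImmersion (𝟙 (projectiveSpace K ℂ) : projectiveSpace K ℂ ⟶ _).left :=
    show IsClosedImmersion (𝟙 (projectiveSpace K ℂ).left) from inferInstance
  have hamp : ((GeneratingSections.affineChartData (𝟙 (projectiveSpace K ℂ))).divisor j hj).IsAmple := by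
    haveI : CompactSpace (projectiveSpace K ℂ).left := inferInstanceAs (CompactSpace (ProjSpace.P K ℂ))
    exact GeneratingSections.isAmple_divisor _ j hj (GeneratingSections.isAffineOpen_ofHom_U (𝟙 (ProjSpace.P K ℂ)))
  have hne := chernCharacter_cartierDivisorCocycle_ne_zero_of_isAmple (isSmoothProjective_projectiveSpace' K) B hK hamp
  rw [B.chernCharacter_cartierDivisorCocycle_divisor_eq_neg (𝟙 (projectiveSpace K ℂ)) j hj, h0, neg_zero] at hne
  exact hne rfl

variable [T2Space (ComplexPoints (projectiveSpace K ℂ))] [ParacompactSpace (ComplexPoints (projectiveSpace K ℂ))]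

/-- **The line bridge on `ℙᴷ`: `e_ℂ(𝒪_{ℙᴷ}(-D_𝟙)^top) = μ • ch₁ᴮ(𝒪_{ℙᴷ}(-1))` with `μ ≠ 0`** (`K ≥ 1`) — two non-zero vectors of the line
`H²(ℙᴷ(ℂ); ℂ)` (the topological one by ★ `coreEulerClass_neg_divisor_projectiveSpace_ne_zero`, Milnor–Stasheff Thm. 14.4).
[cite: MilnorStasheff1974, §14 Thm. 14.4] [cite: HatcherAT2002, Thm. 3.19] -/
theorem exists_ne_zero_coreEulerClass_eq_smul_chernCharacter_projectiveSpace (j : Fin (K + 1))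
    (hj : genericPoint (projectiveSpace K ℂ).left ∈ (GeneratingSections.affineChartData (𝟙 (projectiveSpace K ℂ))).U j) (hK : 1 ≤ K) :
    ∃ μ : ℂ, μ ≠ 0 ∧
      eulerClass ℂ (-(GeneratingSections.affineChartData (𝟙 (projectiveSpace K ℂ))).divisor j hj).toUnitCocycle.complexCore.Fiber
          (Module.finrank_self ℂ) ℂ 1 =
        μ • B.chernCharacter (tautologicalBundle (𝟙 (projectiveSpace K ℂ)) B.isAnalytification) 1 := by
  obtain ⟨μ, hμ, hμ0⟩ := exists_smul_eq_of_ne_zero_complexBetti_projectiveSpace_two hK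
    (chernCharacter_tautologicalBundle_projectiveSpace_ne_zero B j hj hK)
    (eulerClass ℂ (-(GeneratingSections.affineChartData (𝟙 (projectiveSpace K ℂ))).divisor j hj).toUnitCocycle.complexCore.Fiber
      (Module.finrank_self ℂ) ℂ 1)
  exact ⟨μ, hμ0 (coreEulerClass_neg_divisor_projectiveSpace_ne_zero j hj hK), hμ⟩

end ProjectiveSpace

/-! ### §3 Along a morphism `ψ : Y ⟶ ℙᴷ`: the topological class of `𝒪_Y(-D_ψ)` is a non-zero multiple of `ch₁ᴬ((ψ^an)⁻¹𝒪(-1))` -/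

section Pullback

variable {n K : ℕ} {Y : SchemeOver ℂ} [IsIntegral Y.left] (hY : IsSmoothProjective n Y) (A : HodgeModel n Y)
  (B : HodgeModel K (projectiveSpace K ℂ)) (ψ : Y ⟶ projectiveSpace K ℂ) (j : Fin (K + 1))
  (hj : genericPoint Y.left ∈ (GeneratingSections.affineChartData ψ).U j)
  [T2Space (ComplexPoints Y)] [ParacompactSpace (ComplexPoints Y)]
  [T2Space (ComplexPoints (projectiveSpace K ℂ))] [ParacompactSpace (ComplexPoints (projectiveSpace K ℂ))]

/-- **The line bridge along `ψ : Y ⟶ ℙᴷ`: `e_ℂ(𝒪_Y(-D_ψ)^top) = ν • ch₁ᴬ((ψ^an)⁻¹𝒪_{ℙᴷ}(-1))`, `ν ≠ 0`** (`Y` smooth projective of dimension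
`n ≤ K`, `K ≥ 1`, Hodge models `A` of `Y`, `B` of `ℙᴷ`): the topological side is natural on the nose (★ `coreEulerClass_neg_divisor_eq_map`,
Husemoller (C₁)), the Chern–Weil side up to the models' scalar `r ≠ 0` (★ `HodgeModel.exists_chernCharacter_tautologicalBundle_pullback_eq_smul_map`,
Kobayashi II §1 Axiom 2), and on `ℙᴷ` the two classes are proportional (§2); `ν = μ r⁻¹`.
[cite: Kobayashi1987, Ch. II §1 Axiom 2 and §2 Thm. 2.16] [cite: HusemollerFibreBundles1994, Ch. 17 Prop. 3.3] [cite: MilnorStasheff1974, §14 Thm. 14.4] -/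
theorem exists_ne_zero_coreEulerClass_eq_smul_chernCharacter_pullback (hK : 1 ≤ K) (hnK : n ≤ K) :
    ∃ ν : ℂ, ν ≠ 0 ∧
      eulerClass ℂ (-(GeneratingSections.affineChartData ψ).divisor j hj).toUnitCocycle.complexCore.Fiber (Module.finrank_self ℂ) ℂ 1 =
        ν • A.chernCharacter
          ((tautologicalBundle (𝟙 (projectiveSpace K ℂ)) B.isAnalytification).pullback (HodgeModel.anMap B A ψ)
            (HodgeModel.contMDiff_anMap B A ψ hY (isSmoothProjective_projectiveSpace' K))) 1 := by
  -- Kobayashi's naturality up to the models' scalar `r ≠ 0`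
  haveI hid : IsClosedImmersion (𝟙 (projectiveSpace K ℂ) : projectiveSpace K ℂ ⟶ _).left :=
    show IsClosedImmersion (𝟙 (projectiveSpace K ℂ).left) from inferInstance
  obtain ⟨r, hr0, hr⟩ := HodgeModel.exists_chernCharacter_tautologicalBundle_pullback_eq_smul_map hY A B hnK
  -- the hyperplane divisor of `ℙᴷ` in the chart `j` (the generic point of `ℙᴷ` lies in every `D₊(x_j)`)
  have hjP : genericPoint (projectiveSpace K ℂ).left ∈ (GeneratingSections.affineChartData (𝟙 (projectiveSpace K ℂ))).U j :=
    ProjSpace.genericPoint_mem_U (d := K) (K := ℂ) j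
  obtain ⟨μ, hμ0, hμ⟩ := exists_ne_zero_coreEulerClass_eq_smul_chernCharacter_projectiveSpace B j hjP hK
  refine ⟨μ * r⁻¹, mul_ne_zero hμ0 (inv_ne_zero hr0), ?_⟩
  rw [coreEulerClass_neg_divisor_eq_map ψ j hj ℂ j hjP 1, hμ, _root_.map_smul, mul_smul, hr ψ, smul_smul r⁻¹ r, inv_mul_cancel₀ hr0,
    one_smul]


/-- **Explicit-scalar form of the bridge along `ψ`** (for assemblers that feed ONE rigidity scalar `r` uniformly over a family of fibres,
★ `HodgeModel.chernCharacter_pullback_eq_smul_map_of_deRham_eq_smul`): if `A.deRham = r • inducedIso B A` in degree `2` (`r ≠ 0`) and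
`e_ℂ(𝒪_{ℙᴷ}(-D_𝟙)^top) = μ • ch₁ᴮ(𝒪(-1))` on `ℙᴷ` (§2, `μ` depends on `ℙᴷ`, `B` and the chart only), then
`e_ℂ(𝒪_Y(-D_ψ)^top) = (μ r⁻¹) • ch₁ᴬ((ψ^an)⁻¹𝒪(-1))`. [cite: Kobayashi1987, Ch. II §1 Axiom 2 and §2 Thm. 2.16]
[cite: HusemollerFibreBundles1994, Ch. 17 Prop. 3.3] -/
theorem coreEulerClass_eq_smul_chernCharacter_pullback_of_deRham_eq_smul (hnK : n ≤ K) {r : ℂ} (hr0 : r ≠ 0)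
    (hr : ∀ y : complexDeRhamCohomology A.model A.carrier (2 * 1),
      A.deRham A.carrier (2 * 1) y = r • HodgeModel.inducedIso B A hnK A.carrier (2 * 1) y)
    (j₁ : Fin (K + 1))
    (hj₁ : genericPoint (projectiveSpace K ℂ).left ∈ (GeneratingSections.affineChartData (𝟙 (projectiveSpace K ℂ))).U j₁) {μ : ℂ}
    (hμ : eulerClass ℂ (-(GeneratingSections.affineChartData (𝟙 (projectiveSpace K ℂ))).divisor j₁ hj₁).toUnitCocycle.complexCore.Fiber
        (Module.finrank_self ℂ) ℂ 1 =
      μ • B.chernCharacter (tautologicalBundle (𝟙 (projectiveSpace K ℂ)) B.isAnalytification) 1) :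
    eulerClass ℂ (-(GeneratingSections.affineChartData ψ).divisor j hj).toUnitCocycle.complexCore.Fiber (Module.finrank_self ℂ) ℂ 1 =
      (μ * r⁻¹) • A.chernCharacter
        ((tautologicalBundle (𝟙 (projectiveSpace K ℂ)) B.isAnalytification).pullback (HodgeModel.anMap B A ψ)
          (HodgeModel.contMDiff_anMap B A ψ hY (isSmoothProjective_projectiveSpace' K))) 1 := by
  have hψ := HodgeModel.chernCharacter_pullback_eq_smul_map_of_deRham_eq_smul A B hnK (p := 1) hr ψ
    (HodgeModel.contMDiff_anMap B A ψ hY (isSmoothProjective_projectiveSpace' K))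
    (tautologicalBundle (𝟙 (projectiveSpace K ℂ)) B.isAnalytification) (tautologicalConnection (𝟙 (projectiveSpace K ℂ)) B.isAnalytification)
  rw [coreEulerClass_neg_divisor_eq_map ψ j hj ℂ j₁ hj₁ 1, hμ, _root_.map_smul, mul_smul, hψ, smul_smul r⁻¹ r, inv_mul_cancel₀ hr0,
    one_smul]

end Pullback

end Literature.AlgebraicGeometry.HodgeTheory

end
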